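import Summits.HubbardSuperconductivity.HubbardSuperconductivity.Theorems.InfiniteVolumeFirstNoNormalLimitStateStubWindowFloorAtom

/-!
# Mesoscopic pair order controls the window sums and the condensate atoms

Support for the cruxes `NoInfraredPileUp` (stmt-HubbardSuperconductivity-18534) and
`NoNormalLimitState` (stmt-HubbardSuperconductivity-18533) of route `InfiniteVolumeFirst`: the two
harmonic-analysis reductions (steps S10/S11 of the coarse-tightness / atom-ceiling programme,
`PLAN-coarse-tightness.md` attached to the item) by which ONE quantity — the MESOSCOPIC PAIR ORDER
at block scale `R` of a torus vector `φ` at side `L`,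

  `𝓜_R(φ) := (Σ_{a ∈ (ℤ/L)²} ‖B_a φ‖²) / (L² R⁴)`,  `B_a = Σ_{u ∈ [0,R)²} P_{a+u}`

(`P_x = localPair d L x`; by `tightnessExchange_boxSum_eq` this is exactly the box average
`R⁻⁴ Σ_{x,y ∈ [0,R)²} C_L(x - y)` of the translation-averaged `d`-wave pair correlation `C_L`) —
bounds both objects of the route:

* `boxAvg_corrAvg_eq_mesoOrder` — the identification just quoted;
* `windowSum_le_two_mul_mesoOrder` — **window sums**: for `R > 0`, `ε ≥ 0` with `ε R ≤ 1/8`,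
  `Σ_{m ≠ 0, |q_m| ≤ ε} S_L(m) ≤ Σ_{|q_m| ≤ ε} S_L(m) ≤ 2 L² 𝓜_R(φ_L)` (the landed windowed Fejér
  lower bound `windowSum_le_boxAvg`, `1 - 4εR ≥ 1/2`);
* `boxAvg_limit_le_of_eventually_le` — **condensate atoms**: along a sequence of sides on which the
  translation-averaged correlations converge pointwise to `C`, an eventual bound `𝓜_R ≤ Θ` passes
  to the limit, `R⁻⁴ Σ_{x,y ∈ [0,R)²} C(x - y) ≤ Θ`; hence (`liminf_boxAvg_le_of_eventually_le`) the
  Bochner atom `liminf_R R⁻⁴ Σ_{x,y} C(x - y)` of the limit is at most `liminf_R Θ_R` — with NO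
  tightness hypothesis (contrast: without a mesoscopic bound only `atom ≥ limsup LRO` is available).

So a ceiling `𝓜_R(ψ_L) ≤ Θ(R, U)` for the ground states of the weak-coupling Hubbard torus (steps
S5–S9 of the programme) yields at once coarse tightness (`∀ η ∃ U_η …`) in the format of
`NoInfraredPileUp` and the unconditional atom ceiling `atom ≤ liminf_R Θ(R, U)` in the format of
`NoNormalLimitState`; the registered stub of this file is the window reduction
(`stub_coarseWindowSumLeMesoOrder`).

Sources: T. Kennedy, E. H. Lieb, B. S. Shastry, PRL 61 (1988) 2582 (Fourier modes, sum rule);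
S. Friedli, Y. Velenik, *Statistical Mechanics of Lattice Systems* (2017) §10.4 (Fejér kernel);
J. Fröhlich, B. Simon, T. Spencer, CMP 50 (1976) 79, §3. Folklore finite-dimensional harmonic
analysis and limits; no definition and no named fact is introduced.
-/

noncomputable section

-- the mandated namespace `Summit.<Summit>.<Problem>.Theorems` repeats `HubbardSuperconductivity`
-- (single-problem summit, D-0017), which the `dupNamespace` linter flags on every declaration
set_option linter.dupNamespace false

namespace Summit.HubbardSuperconductivity.HubbardSuperconductivity.Theorems.CoarseTightness

open Literature.MathematicalPhysics.QuantumLattice Literature.Probability.LatticeModels Matrix Finset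
  Filter
open Summit.HubbardSuperconductivity.HubbardSuperconductivity.Theorems.NoNormalLimitState
open scoped ComplexConjugate ComplexOrder Topology

/-! ### Box averages of the translation-averaged correlation are the mesoscopic pair order -/

/-- **`R⁻⁴ Σ_{x,y ∈ [0,R)²} C_L(x - y) = (Σ_a ‖B_a ψ_L‖²) / (L² R⁴)`** at the side `L = n + 1`: the
box average of the translation-averaged pair correlation is the mesoscopic pair order (block pair
coherence summed over the translates, `tightnessExchange_boxSum_eq`). Kennedy–Lieb–Shastry,
PRL 61 (1988) 2582. [folklore] -/
theorem boxAvg_corrAvg_eq_mesoOrder (ψ : ∀ L, Fock (Orb (FermionTorus 2 L))) (n R : ℕ) :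
    (∑ x ∈ halfOpenBox 2 R, ∑ y ∈ halfOpenBox 2 R,
        (∑ w ∈ halfOpenBox 2 (n + 1),
          torusPullback (pairFieldCorr dWaveFormFactor ψ) (n + 1) (x - y + w) w) /
            ((n + 1 : ℕ) : ℝ) ^ 2) / (R : ℝ) ^ 4 =
      (∑ a : TorusSite 2 (n + 1),
          (star ((∑ u : Fin 2 → Fin R,
              localPair dWaveFormFactor (n + 1) (a + fun i => ((u i : ℕ) : ZMod (n + 1)))) *ᵥ
                ψ (n + 1)) ⬝ᵥ
            ((∑ u : Fin 2 → Fin R,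
              localPair dWaveFormFactor (n + 1) (a + fun i => ((u i : ℕ) : ZMod (n + 1)))) *ᵥ
                ψ (n + 1))).re) / (((n + 1 : ℕ) : ℝ) ^ 2 * (R : ℝ) ^ 4) := by
  rw [tightnessExchange_boxSum_eq, Complex.re_sum, Finset.sum_div, Finset.sum_div, Finset.sum_div]
  refine Finset.sum_congr rfl fun a _ => ?_
  rw [div_div]

/-! ### Reduction 1: window sums -/

/-- **Window sums are controlled by the mesoscopic pair order.** For any family `ψ`, side
`L = n + 1`, block scale `R > 0` and window `ε ≥ 0` with `ε R ≤ 1/8`: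
`Σ_{m ≠ 0, |q_m|² ≤ ε²} S_L(m) ≤ 2 · (Σ_a ‖B_a ψ_L‖²) / R⁴` (`= 2 L² 𝓜_R(ψ_L)`): drop the cut `m ≠ 0`
(nonnegative terms), apply the windowed Fejér lower bound `windowSum_le_boxAvg` and `1 - 4εR ≥ 1/2`.
Kennedy–Lieb–Shastry, PRL 61 (1988) 2582; Friedli–Velenik (2017) §10.4. [folklore] -/
theorem windowSum_le_two_mul_mesoOrder (ψ : ∀ L, Fock (Orb (FermionTorus 2 L))) (n R : ℕ)
    (hR : 0 < R) {ε : ℝ} (hε : 0 ≤ ε) (hεR : ε * R ≤ 1 / 8) :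
    (∑ m : TorusSite 2 (n + 1), if m ≠ 0 ∧ momentumNormSq (n + 1) m ≤ ε ^ 2 then
        pairStructureFactor dWaveFormFactor (n + 1) (ψ (n + 1)) m else 0) ≤
      2 * (∑ a : TorusSite 2 (n + 1),
          (star ((∑ u : Fin 2 → Fin R,
              localPair dWaveFormFactor (n + 1) (a + fun i => ((u i : ℕ) : ZMod (n + 1)))) *ᵥ
                ψ (n + 1)) ⬝ᵥ
            ((∑ u : Fin 2 → Fin R,
              localPair dWaveFormFactor (n + 1) (a + fun i => ((u i : ℕ) : ZMod (n + 1)))) *ᵥ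
                ψ (n + 1))).re) / (R : ℝ) ^ 4 := by
  have hL : (0 : ℝ) < ((n + 1 : ℕ) : ℝ) := by positivity
  have hRpos : (0 : ℝ) < R := Nat.cast_pos.2 hR
  -- drop the cut `m ≠ 0`
  have hcut : (∑ m : TorusSite 2 (n + 1), if m ≠ 0 ∧ momentumNormSq (n + 1) m ≤ ε ^ 2 then
        pairStructureFactor dWaveFormFactor (n + 1) (ψ (n + 1)) m else 0) ≤
      ∑ m : TorusSite 2 (n + 1), if momentumNormSq (n + 1) m ≤ ε ^ 2 then
        pairStructureFactor dWaveFormFactor (n + 1) (ψ (n + 1)) m else 0 := by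
    refine Finset.sum_le_sum fun m _ => ?_
    by_cases h1 : m ≠ 0 ∧ momentumNormSq (n + 1) m ≤ ε ^ 2
    · rw [if_pos h1, if_pos h1.2]
    · rw [if_neg h1]
      split_ifs
      · exact pairStructureFactor_nonneg _ _ _ _
      · exact le_rfl
  -- the windowed Fejér lower bound, rewritten through the mesoscopic pair order
  have hF := windowSum_le_boxAvg ψ n R hR hε
  rw [boxAvg_corrAvg_eq_mesoOrder] at hF
  set W := ∑ m : TorusSite 2 (n + 1), if momentumNormSq (n + 1) m ≤ ε ^ 2 then
      pairStructureFactor dWaveFormFactor (n + 1) (ψ (n + 1)) m else 0 with hW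
  set M := ∑ a : TorusSite 2 (n + 1),
      (star ((∑ u : Fin 2 → Fin R,
          localPair dWaveFormFactor (n + 1) (a + fun i => ((u i : ℕ) : ZMod (n + 1)))) *ᵥ
            ψ (n + 1)) ⬝ᵥ
        ((∑ u : Fin 2 → Fin R,
          localPair dWaveFormFactor (n + 1) (a + fun i => ((u i : ℕ) : ZMod (n + 1)))) *ᵥ
            ψ (n + 1))).re with hM
  have hW0 : 0 ≤ W := Finset.sum_nonneg fun m _ => by
    split_ifs
    · exact pairStructureFactor_nonneg _ _ _ _
    · exact le_rfl
  have hhalf : (1 : ℝ) / 2 ≤ 1 - 4 * ε * R := by nlinarith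
  -- `(1/2) W / L² ≤ (1 - 4εR) W / L² ≤ M / (L² R⁴)`
  have h1 : (1 : ℝ) / 2 * (W / ((n + 1 : ℕ) : ℝ) ^ 2) ≤ M / (((n + 1 : ℕ) : ℝ) ^ 2 * (R : ℝ) ^ 4) :=
    (mul_le_mul_of_nonneg_right hhalf (by positivity)).trans hF
  have h2 : W ≤ 2 * M / (R : ℝ) ^ 4 := by
    rw [div_mul_eq_div_div] at h1
    have h3 : (1 : ℝ) / 2 * (W / ((n + 1 : ℕ) : ℝ) ^ 2) * ((n + 1 : ℕ) : ℝ) ^ 2 ≤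
        M / ((n + 1 : ℕ) : ℝ) ^ 2 / (R : ℝ) ^ 4 * ((n + 1 : ℕ) : ℝ) ^ 2 :=
      mul_le_mul_of_nonneg_right h1 (by positivity)
    rw [show (1 : ℝ) / 2 * (W / ((n + 1 : ℕ) : ℝ) ^ 2) * ((n + 1 : ℕ) : ℝ) ^ 2 = W / 2 by
      field_simp, show M / ((n + 1 : ℕ) : ℝ) ^ 2 / (R : ℝ) ^ 4 * ((n + 1 : ℕ) : ℝ) ^ 2 =
      M / (R : ℝ) ^ 4 by field_simp] at h3
    rw [mul_div_assoc]
    linarith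
  exact hcut.trans h2

/-- **Registered stub** (`stub_coarseWindowSumLeMesoOrder`, crux stmt-HubbardSuperconductivity-18534):
the window reduction in closed form — for every family, side `n + 1`, block scale `R > 0` and
window `ε ≥ 0` with `ε R ≤ 1/8`, the small-momentum window sum of the `d`-wave pair structure
factor is at most twice the block pair coherence summed over the translates, over `R⁴`.
Kennedy–Lieb–Shastry, PRL 61 (1988) 2582. [folklore] -/
theorem stub_coarseWindowSumLeMesoOrder :
    ∀ (ψ : ∀ L, Fock (Orb (FermionTorus 2 L))) (n R : ℕ), 0 < R → ∀ (ε : ℝ), 0 ≤ ε → ε * R ≤ 1 / 8 →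
      (∑ m : TorusSite 2 (n + 1), if m ≠ 0 ∧ momentumNormSq (n + 1) m ≤ ε ^ 2 then
          pairStructureFactor dWaveFormFactor (n + 1) (ψ (n + 1)) m else 0) ≤
        2 * (∑ a : TorusSite 2 (n + 1),
            (star ((∑ u : Fin 2 → Fin R,
                localPair dWaveFormFactor (n + 1) (a + fun i => ((u i : ℕ) : ZMod (n + 1)))) *ᵥ
                  ψ (n + 1)) ⬝ᵥ
              ((∑ u : Fin 2 → Fin R,
                localPair dWaveFormFactor (n + 1) (a + fun i => ((u i : ℕ) : ZMod (n + 1)))) *ᵥ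
                  ψ (n + 1))).re) / (R : ℝ) ^ 4 :=
  fun ψ n R hR _ hε hεR => windowSum_le_two_mul_mesoOrder ψ n R hR hε hεR

/-! ### Reduction 2: condensate atoms of pointwise limits -/

/-- **An eventual bound on the box averages passes to every pointwise limit.** If the
translation-averaged correlations `C_{L_j}` converge pointwise to `C` along a sequence of sides and
their box average at scale `R` is eventually at most `Θ`, then `R⁻⁴ Σ_{x,y ∈ [0,R)²} C(x - y) ≤ Θ`
(finite sums of convergent sequences). Fröhlich–Simon–Spencer (1976) §3 (passage to the limit in
the infrared bound). [folklore] -/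
theorem boxAvg_limit_le_of_eventually_le (Cavg : ℕ → Site 2 → ℝ) (C : Site 2 → ℝ) (Ls : ℕ → ℕ)
    (hconv : ∀ x : Site 2, Tendsto (fun j => Cavg (Ls j) x) atTop (𝓝 (C x))) (R : ℕ) (Θ : ℝ)
    (h : ∀ᶠ j in atTop, (∑ x ∈ halfOpenBox 2 R, ∑ y ∈ halfOpenBox 2 R, Cavg (Ls j) (x - y)) /
      ((R : ℕ) : ℝ) ^ 4 ≤ Θ) :
    (∑ x ∈ halfOpenBox 2 R, ∑ y ∈ halfOpenBox 2 R, C (x - y)) / ((R : ℕ) : ℝ) ^ 4 ≤ Θ := by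
  have hbj : Tendsto (fun j => (∑ x ∈ halfOpenBox 2 R, ∑ y ∈ halfOpenBox 2 R,
      Cavg (Ls j) (x - y)) / ((R : ℕ) : ℝ) ^ 4) atTop
      (𝓝 ((∑ x ∈ halfOpenBox 2 R, ∑ y ∈ halfOpenBox 2 R, C (x - y)) / ((R : ℕ) : ℝ) ^ 4)) :=
    (tendsto_finsetSum _ fun x _ => tendsto_finsetSum _ fun y _ => hconv (x - y)).div_const _
  exact le_of_tendsto hbj h

/-- **The atom of a limit is at most the liminf of eventual box-average bounds.** If, for every
block scale `R ≥ R₀`, the box averages of `C_{L_j}` at scale `R` are eventually (in `j`) at most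
`Θ R` (`Θ` bounded above), and `C` is bounded (`|C| ≤ B`), then the Bochner atom of the limit obeys
`liminf_R R⁻⁴ Σ_{x,y ∈ [0,R)²} C(x - y) ≤ liminf_R Θ R`. No tightness is assumed: this is the
UNCONDITIONAL direction in which a mesoscopic pair-order ceiling bounds infinite-volume condensate
atoms. Fröhlich–Simon–Spencer (1976) §3; Friedli–Velenik (2017) §10.4. [folklore] -/
theorem liminf_boxAvg_le_of_eventually_le (Cavg : ℕ → Site 2 → ℝ) (C : Site 2 → ℝ) (Ls : ℕ → ℕ)
    (hconv : ∀ x : Site 2, Tendsto (fun j => Cavg (Ls j) x) atTop (𝓝 (C x))) {B : ℝ}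
    (hCB : ∀ x, |C x| ≤ B) (Θ : ℕ → ℝ) (R₀ : ℕ)
    (h : ∀ R, R₀ ≤ R → ∀ᶠ j in atTop, (∑ x ∈ halfOpenBox 2 R, ∑ y ∈ halfOpenBox 2 R,
      Cavg (Ls j) (x - y)) / ((R : ℕ) : ℝ) ^ 4 ≤ Θ R)
    (hΘ : IsBoundedUnder (· ≤ ·) atTop Θ) :
    liminf (fun R : ℕ => (∑ x ∈ halfOpenBox 2 R, ∑ y ∈ halfOpenBox 2 R, C (x - y)) /
        ((R : ℕ) : ℝ) ^ 4) atTop ≤ liminf Θ atTop := by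
  have hB0 : 0 ≤ B := (abs_nonneg _).trans (hCB 0)
  -- a priori lower bound of the box averages of `C`
  have hb_low : ∀ R : ℕ, -B ≤ (∑ x ∈ halfOpenBox 2 R, ∑ y ∈ halfOpenBox 2 R, C (x - y)) /
      ((R : ℕ) : ℝ) ^ 4 := by
    intro R
    have habs : |(∑ x ∈ halfOpenBox 2 R, ∑ y ∈ halfOpenBox 2 R, C (x - y)) /
        ((R : ℕ) : ℝ) ^ 4| ≤ B := by
      rw [abs_div, abs_of_nonneg (by positivity : (0 : ℝ) ≤ ((R : ℕ) : ℝ) ^ 4)]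
      rcases Nat.eq_zero_or_pos R with rfl | hRpos
      · simpa using hB0
      · rw [div_le_iff₀ (by positivity)]
        calc |∑ x ∈ halfOpenBox 2 R, ∑ y ∈ halfOpenBox 2 R, C (x - y)|
            ≤ ∑ x ∈ halfOpenBox 2 R, |∑ y ∈ halfOpenBox 2 R, C (x - y)| :=
              Finset.abs_sum_le_sum_abs _ _
          _ ≤ ∑ x ∈ halfOpenBox 2 R, ∑ y ∈ halfOpenBox 2 R, |C (x - y)| :=
              Finset.sum_le_sum fun x _ => Finset.abs_sum_le_sum_abs _ _
          _ ≤ ∑ x ∈ halfOpenBox 2 R, ∑ y ∈ halfOpenBox 2 R, B :=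
              Finset.sum_le_sum fun x _ => Finset.sum_le_sum fun y _ => hCB _
          _ = B * ((R : ℕ) : ℝ) ^ 4 := by
              rw [Finset.sum_const, Finset.sum_const, card_halfOpenBox, smul_smul, nsmul_eq_mul]
              push_cast
              ring
    exact (abs_le.1 habs).1
  -- eventually in `R`, the box average of `C` is at most `Θ R`
  have hev : ∀ᶠ R : ℕ in atTop, (∑ x ∈ halfOpenBox 2 R, ∑ y ∈ halfOpenBox 2 R, C (x - y)) /
      ((R : ℕ) : ℝ) ^ 4 ≤ Θ R := by
    filter_upwards [eventually_ge_atTop R₀] with R hR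
    exact boxAvg_limit_le_of_eventually_le Cavg C Ls hconv R (Θ R) (h R hR)
  exact liminf_le_liminf hev (isBoundedUnder_of ⟨-B, fun R => hb_low R⟩) hΘ.isCoboundedUnder_ge

end Summit.HubbardSuperconductivity.HubbardSuperconductivity.Theorems.CoarseTightness

end
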